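import Summits.ResolutionOfSingularities.ResolutionOfSingularities.Theorems.EquisingularLiftEquisingularLiftNatSpecimenS10ConicUnobs
import Summits.ResolutionOfSingularities.ResolutionOfSingularities.Theorems.EquisingularLiftEquisingularLiftNatDirStepUnobsHostChange
import HarnessLib

/-!
# [OURS · L1 W4.5(b) · EL♮(3) · WIDTH TABLE D3, brick D3-8 (3/2, transport)] The conic certificate of `DirStepUnobs` ALONG ANY ISOMORPHISM:
# every image of the standard conic `V₊(X₀X₁ + X₂²) ⊂ ℙ²_k` under an isomorphism `ℙ²_k ≅ Y` onto a reduced scheme is unobstructed in `Y`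

Cell `res-hironaka`, LADDER-RESOLUTION rung L (D-0089), slot W4.5(b), crux chain w45b: child crux **EL♮(3)** = stmt-ResolutionOfSingularities-20148;
WIDTH seat res-L1-w45b-iso-w4 g2 (D-0157 DOOR 1), desk booking D3-8 and its transport offer Q-w4′ (i) (STATUS 2026-08-28T18:51:57Z).
`--supports stmt-ResolutionOfSingularities-20148 --as helper`. OURS; NOT a statement of H. Hironaka's 2017 manuscript (nothing of [Hironaka2017] is
asserted); AI-written, and AI review is weaker than expert review. DEF-FREE; no `sorry`; standard axioms. EL♮(3) is NOT proved here; resolution of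
singularities in positive characteristic is NOT proved here (dimension 3 is Cossart–Piltant 2008/2009 in print); counted 0 toward the summit.

WHAT. `S10Conic.dirStepUnobs_conic_of_iso` — for every field `k`, every REDUCED scheme `Y` and every isomorphism `φ : ℙ²_k ≅ Y`
(`ℙ²_k = Proj k[X₀,X₁,X₂]`): `DirStepUnobs Y univ _ (φ '' V₊(X₀X₁ + X₂²)) _` — the MODEL certificate ✓ `S10Conic.dirStepUnobs_conic` (p658550)
transported along `φ` by res-L1-w45b-stub-2's B0 `dirStepUnobs_transport` with res-L1-w45b-iso-w2's host kit (`exists_isIso_redSub_univ_over`,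
✓ `…NatDirStepUnobsHostChange`) and `exists_isIso_redSub_image` (✓ `…NatSectionRootTransport`). USE: (a) with `Y = ℙ²_k` and `φ` an automorphism
(a linear change of coordinates), every conic PROJECTIVELY EQUIVALENT to the normal form is unobstructed — the shape the ∀-isomorphism door
✓ `dirStepUnobs_freshPlane_of_forall_model` (p656762) consumes once the customer identifies `e⁻¹(Z)` as such a conic; (b) with `Y = Ẽ_q` a fresh
plane and `φ` the customer's explicit iso it is the NEST clause at host `univ`, to be pushed to the host `E_q ⊊ G'` by ✓ (H1)
`dirStepUnobs_of_univ_redSub`. The closedness witness of the image is quantified (any proof; `DirStepUnobs` is proof-irrelevant in it).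

References (index only): R. Hartshorne, *Algebraic Geometry* (1977), III.5 [cite: Hartshorne1977].
-/

set_option linter.dupNamespace false

noncomputable section

-- `TopCat.Presheaf`/`Scheme.Modules` are not reducible (as in Mathlib's `AlgebraicGeometry/Modules`).
set_option backward.isDefEq.respectTransparency false

open CategoryTheory AlgebraicGeometry Opposite TopologicalSpace MvPolynomial

namespace Summit.ResolutionOfSingularities.ResolutionOfSingularities.Cruxes.EquisingularLiftNat.Sections

namespace S10Conic

open Literature.AlgebraicGeometry.Motives

variable (k : Type) [Field k]

attribute [local instance] MvPolynomial.gradedAlgebra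

/-- ★★ **THE CONIC CERTIFICATE ALONG ANY ISOMORPHISM.** For a reduced scheme `Y` and an isomorphism `φ : ℙ²_k ≅ Y`, the image
`φ(V₊(X₀X₁ + X₂²))` is unobstructed in `Y` at host `univ`: `DirStepUnobs Y univ _ (φ '' V₊(X₀X₁+X₂²)) hZ` for every closedness witness `hZ`
(transport of ✓ `dirStepUnobs_conic` along `φ.hom` by B0). [OURS · L1 W4.5b · EL♮(3) · D3-8 transport; NOT a statement of the manuscript; counted 0] -/
theorem dirStepUnobs_conic_of_iso {Y : Scheme.{0}} [IsReduced Y]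
    (φ : Proj (MvPolynomial.homogeneousSubmodule (Fin 3) k) ≅ Y)
    (hZ : IsClosed ((φ.hom : Proj (MvPolynomial.homogeneousSubmodule (Fin 3) k) → Y) ''
      (SmoothHypersurface.zeroLocusClosed (X 0 * X 1 + X 2 ^ 2 : MvPolynomial (Fin 3) k) : Set _))) :
    DirStepUnobs Y Set.univ isClosed_univ
      ((φ.hom : Proj (MvPolynomial.homogeneousSubmodule (Fin 3) k) → Y) ''
        (SmoothHypersurface.zeroLocusClosed (X 0 * X 1 + X 2 ^ 2 : MvPolynomial (Fin 3) k) : Set _)) hZ := by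
  haveI : IsIntegral (Proj (MvPolynomial.homogeneousSubmodule (Fin 3) k)) :=
    Literature.AlgebraicGeometry.Resolution.isIntegral_projectiveSpace 2 k
  -- the isomorphism of the reduced structures at host `univ`, over `φ.hom`
  obtain ⟨ε, hε, hεiso⟩ := exists_isIso_redSub_univ_over φ.hom
  haveI := hεiso
  -- the induced isomorphism of the reduced conic onto the reduced image
  obtain ⟨hc, εZ, hεZ, hεZiso⟩ := exists_isIso_redSub_image φ.hom (E := Set.univ) isClosed_univ isClosed_univ ε hε
    (SmoothHypersurface.zeroLocusClosed (X 0 * X 1 + X 2 ^ 2 : MvPolynomial (Fin 3) k)).isClosed (Set.subset_univ _)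
  exact dirStepUnobs_transport (Proj (MvPolynomial.homogeneousSubmodule (Fin 3) k)) Set.univ isClosed_univ _ _ Y φ.hom Set.univ
    isClosed_univ _ hc ε εZ (Set.subset_univ _) (Set.subset_univ _) hεiso hε hεZiso hεZ (dirStepUnobs_conic k)

end S10Conic

end Summit.ResolutionOfSingularities.ResolutionOfSingularities.Cruxes.EquisingularLiftNat.Sections

end
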